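import Mathlib
import HarnessLib
import Literature.MathematicalPhysics.StatisticalMechanics.StepOperatorABKM
import Literature.MathematicalPhysics.StatisticalMechanics.RelevantHamiltonianSpace

/-!
# `‖(A_k^{(q)})⁻¹‖ ≤ ¾` for the torus data in operator form: the shift `γ = gradCov 𝒞_{k+1}` is
# `O(L^{−dk})` by clause (iv) of the decomposition, and `A_k` between the Banach spaces `HamSpace`

Wiring of `StepOperatorABKM.hamNorm_stepOpAInv_abkm_le` (Lemma 10.5 at the ABKM scales, under
`L^{dk}|γ_q| ≤ h²`) with the kernel regularity of clause (iv) of the finite-range decomposition in the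
shape recorded by `WeightTheoremABKM.AbkmWeightBounds.regular`
(`|∇^θ𝒞_j(x)| ≤ C_θ L^{−(j−1)(d−2+|θ|)}`) and with the Banach spaces `HamSpace` of
`RelevantHamiltonianSpace`:

* `secondDiffConst Cα` — `Σ_{|θ|_∞ ≤ 2, |θ| = 2} |C_θ|`, a bound for all second differences;
* **`abs_gradCov_abkm_le`** — `L^{dk} |γ_q| ≤ secondDiffConst C` for `γ = gradCov 𝒞_{k+1}`,
  `k + 1 ≤ N + 1` ([ABKM19] (10.39): `|γ_q| ≤ C_{2,0} L^{−kd}`);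
* `Fact` instances `0 < fieldWt h L d k`, `0 < L^k`, `0 < L^{dk}` from `Fact (0 < h)`, `Fact (0 < L)`;
* **`norm_stepOpAEquiv_symm_abkm_le`** — for `h² ≥ secondDiffConst C`:
  `‖(A_k)⁻¹ H'‖_{k,0} ≤ ¾ ‖H'‖_{k+1,0}` as an inequality of `HamSpace` norms (the hypothesis
  `IsRGStepQ.norm_symm_le` with `α = ¾` for the line).

Everything is proved; no named fact.

## References
* S. Adams, S. Buchholz, R. Kotecký, S. Müller, arXiv:1910.13564, Lemma 10.5 ((10.39)), Theorem 6.1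
  (iv) [AdamsBuchholzKoteckyMuller2019].
-/

noncomputable section

namespace Literature.MathematicalPhysics.StatisticalMechanics.GradientRG

open scoped BigOperators
open Finset
open Literature.MathematicalPhysics.StatisticalMechanics.GradientFRD (iterDiff)

variable {d M : ℕ} [NeZero M]

/-! ## The second differences of the kernel -/

/-- `Σ |C_θ|` over the multi-indices with entries `≤ 2` and `|θ| = 2` — a common bound for all
constants of the second differences. [cite: AdamsBuchholzKoteckyMuller2019, Lemma 10.5 (10.39)] -/
def secondDiffConst (Cα : (Fin d → ℕ) → ℝ) : ℝ :=
  ∑ θ ∈ (Fintype.piFinset fun _ : Fin d => Finset.range 3).filter (fun θ => ∑ i, θ i = 2), |Cα θ|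

omit [NeZero M] in
/-- `secondDiffConst ≥ 0`. [cite: AdamsBuchholzKoteckyMuller2019, Lemma 10.5 (10.39)] -/
theorem secondDiffConst_nonneg (Cα : (Fin d → ℕ) → ℝ) : 0 ≤ secondDiffConst Cα :=
  Finset.sum_nonneg fun _ _ => abs_nonneg _

omit [NeZero M] in
/-- Each `C_θ` with `|θ| = 2` is at most `secondDiffConst`. [cite: AdamsBuchholzKoteckyMuller2019, Lemma 10.5 (10.39)] -/
theorem le_secondDiffConst (Cα : (Fin d → ℕ) → ℝ) {θ : Fin d → ℕ} (hθ : ∑ i, θ i = 2) :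
    Cα θ ≤ secondDiffConst Cα := by
  have hmem : θ ∈ (Fintype.piFinset fun _ : Fin d => Finset.range 3).filter (fun θ => ∑ i, θ i = 2) := by
    refine mem_filter.2 ⟨Fintype.mem_piFinset.2 fun i => mem_range.2 ?_, hθ⟩
    have : θ i ≤ ∑ j, θ j := Finset.single_le_sum (fun j _ => Nat.zero_le (θ j)) (mem_univ i)
    omega
  exact (le_abs_self _).trans (Finset.single_le_sum (fun θ _ => abs_nonneg (Cα θ)) hmem)

omit [NeZero M] in
/-- **`L^{dk}|γ_q| ≤ C_{2,0}`** for `γ = gradCov 𝒞_{k+1}`, `k + 1 ≤ N + 1`, from clause (iv) of the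
decomposition (the shape recorded in `AbkmWeightBounds.regular`; regularity order `n ≥ 2`, `d ≥ 2`).
[cite: AdamsBuchholzKoteckyMuller2019, Lemma 10.5 (10.39)] -/
theorem abs_gradCov_abkm_le {L N n : ℕ} {𝒞 : ℕ → (Fin d → ZMod M) → ℝ} (hd : 2 ≤ d) (hn : 2 ≤ n)
    (hL : 1 ≤ L) {Cα : (Fin d → ℕ) → ℝ}
    (hCα : ∀ j, 1 ≤ j → j ≤ N + 1 → ∀ θ' : Fin d → ℕ, ∑ i, θ' i ≤ n →
      ∀ x, |iterDiff θ' (𝒞 j) x| ≤ Cα θ' / (L : ℝ) ^ ((j - 1) * (d - 2 + ∑ i, θ' i)))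
    {k : ℕ} (hk : k + 1 ≤ N + 1) (q : quadIndex d) :
    ((L ^ (d * k) : ℕ) : ℝ) * |gradCov (𝒞 (k + 1)) q| ≤ secondDiffConst Cα := by
  have hLpos : (0 : ℝ) < (L : ℝ) ^ (d * k) := by positivity
  have hbound : ∀ θ' : Fin d → ℕ, ∑ i, θ' i = 2 → ∀ x,
      |iterDiff θ' (𝒞 (k + 1)) x| ≤ secondDiffConst Cα / (L : ℝ) ^ (d * k) := by
    intro θ' hθ' x
    have h1 := hCα (k + 1) (by omega) hk θ' (by omega) x
    have hexp : (k + 1 - 1) * (d - 2 + ∑ i, θ' i) = d * k := by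
      rw [hθ', Nat.add_sub_cancel, show d - 2 + 2 = d by omega, mul_comm]
    rw [hexp] at h1
    exact h1.trans (div_le_div_of_nonneg_right (le_secondDiffConst Cα hθ') hLpos.le)
  have h := abs_gradCov_le hbound q
  push_cast
  rw [mul_comm]
  exact (le_div_iff₀ hLpos).1 h

/-! ## `Fact` instances for the weights -/

section Facts

variable {h : ℝ} {L : ℕ}

/-- `0 < 𝔥_k`. [cite: AdamsBuchholzKoteckyMuller2019, Ch. 6.4 (6.40)] -/
instance fact_fieldWt_pos [hh : Fact (0 < h)] [hL : Fact (0 < L)] (d k : ℕ) :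
    Fact (0 < fieldWt h (L : ℝ) d k) :=
  ⟨fieldWt_pos hh.out (by exact_mod_cast hL.out) d k⟩

/-- `0 < L^k` (real). [cite: AdamsBuchholzKoteckyMuller2019, Ch. 6.4 (6.40)] -/
instance fact_pow_pos_real [hL : Fact (0 < L)] (k : ℕ) : Fact (0 < ((L : ℝ) ^ k)) :=
  ⟨by have := hL.out; positivity⟩

/-- `0 < L^{dk}` (natural). [cite: AdamsBuchholzKoteckyMuller2019, Ch. 6.4 (6.51)] -/
instance fact_pow_pos_nat [hL : Fact (0 < L)] (e : ℕ) : Fact (0 < L ^ e) :=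
  ⟨Nat.pow_pos hL.out⟩

end Facts

/-! ## `‖A_k⁻¹‖ ≤ ¾` between the Banach spaces of two scales -/

omit [NeZero M] in
/-- **Lemma 10.5 in operator form for the torus data**: with `E_k = HamSpace ℂ d 𝔥_k L^k L^{dk}`
(`𝔥_k = fieldWt h L d k`), `d ≥ 3`, `L ≥ 4`, `h² ≥ C_{2,0} = secondDiffConst C`, the decomposition
regular to order `n ≥ 2`, and `γ = gradCov 𝒞_{k+1}` (`k + 1 ≤ N + 1`):
`‖(A_k)⁻¹ H'‖_{E_k} ≤ ¾ ‖H'‖_{E_{k+1}}`. [cite: AdamsBuchholzKoteckyMuller2019, Lemma 10.5] -/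
theorem norm_stepOpAEquiv_symm_abkm_le {L N n : ℕ} {h : ℝ} {𝒞 : ℕ → (Fin d → ZMod M) → ℝ}
    [Fact (0 < h)] [Fact (0 < L)] (hd : 3 ≤ d) (hL : 4 ≤ L) (hn : 2 ≤ n)
    {Cα : (Fin d → ℕ) → ℝ}
    (hCα : ∀ j, 1 ≤ j → j ≤ N + 1 → ∀ θ' : Fin d → ℕ, ∑ i, θ' i ≤ n →
      ∀ x, |iterDiff θ' (𝒞 j) x| ≤ Cα θ' / (L : ℝ) ^ ((j - 1) * (d - 2 + ∑ i, θ' i)))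
    (hh2 : secondDiffConst Cα ≤ h ^ 2) {k : ℕ} (hk : k + 1 ≤ N + 1)
    (H' : HamSpace ℂ d (fieldWt h (L : ℝ) d (k + 1)) ((L : ℝ) ^ (k + 1)) (L ^ (d * (k + 1)))) :
    ‖(stepOpAEquiv (𝕜 := ℂ) (fieldWt h (L : ℝ) d k) ((L : ℝ) ^ k) (L ^ (d * k))
        (fieldWt h (L : ℝ) d (k + 1)) ((L : ℝ) ^ (k + 1)) (L ^ (d * (k + 1)))
        (gradCov (𝒞 (k + 1)))).symm H'‖ ≤ (3 / 4 : ℝ) * ‖H'‖ := by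
  have hh : (0 : ℝ) < h := Fact.out
  rw [HamSpace.norm_def, HamSpace.norm_def, toHam_stepOpAEquiv_symm]
  exact hamNorm_stepOpAInv_abkm_le hd hL hh k
    (fun q => (abs_gradCov_abkm_le (by omega) hn (by omega) hCα hk q).trans hh2) _

end Literature.MathematicalPhysics.StatisticalMechanics.GradientRG

end
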